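import Summits.AtomisticToContinuum.HydrodynamicLimit.Theorems.BoxDissipativeWeakStrongEntropyAdmissibilityStubConcentrationOfPTBCA
import Summits.AtomisticToContinuum.HydrodynamicLimit.Theorems.JParityClosureOddContactSymmetryGibbsInvariance

/-!
# Crux `EntropyAdmissibility` (stmt-AtomisticToContinuum-9903), line `registered` — preliminaries for the open stub
# `stub_positiveTimeBoxConcentration` (S2a): the flow-invariant (constant-profile) case reduces to statics

The registered stub S2a of the line `registered` of the crux
`Summit.AtomisticToContinuum.HydrodynamicLimit.Theses.BoxDissipativeWeakStrong.EntropyAdmissibility` asks, at each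
fixed time `t ∈ [0, T)`, for `L¹(P_N)`-concentration about the Bochner mean of the box functionals
`z ↦ ∫ G(ρ̂, m̂, Ê)(t, z, x) ψ(x) dx` (Borel `G` of linear growth, continuous `ψ`) of `N + 1` deterministic hard
spheres started from the local Gibbs law `P_N`. This file records, as pure measure theory, the one mechanism by
which positive times are reachable with known tools:

* `lintegral_conc_comp_eq` — if a measurable map `S` leaves `μ` invariant (`μ.map S = μ`), the `L¹(μ)` deviation
  of `H ∘ S` about its Bochner mean equals that of `H` (change of variables in both integrals);
* the time-`t` box functional is the STATIC functional `w ↦ ∫ G(Û(w, x)) ψ(x) dx` (`Û = EABirthS2bA.fields`)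
  evaluated at `Φ_t z` (by `rfl`); the static functional is measurable in `w` (`measurable_integral_fields`);
* `lintegral_conc_flow_eq_of_const` / `tendsto_conc_flow_of_const` — for CONSTANT profiles the local Gibbs law
  is invariant under every hard-sphere flow (`map_flow_localGibbsLaw_const`: Liouville's theorem plus conservation
  of energy and momentum), so for every `N`, `t`, flow, window, `G`, `ψ` the time-`t` deviation functional of S2a
  EQUALS the static one; hence S2a along constant profiles is exactly its `t = 0` (statics) instance;
* `lintegral_conc_flow_zero_eq` — for GENERAL profiles the `t = 0` deviation functional equals the static one
  (`Φ_0 = id` on the good set, which carries `P_N`): the `t = 0` instance of S2a is statics.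

Nothing here restates the crux, the stub or the Statement; no `Prop` is taken as a hypothesis, and the only
definition is the signature `Sig.stub_positiveTimeBoxConcentrationPrelim` of the registered helper stub (a conjunction
of three of the theorems below) that anchors this file to the crux item.

References: H. Spohn, *Large Scale Dynamics of Interacting Particles* (1991), Part I §2.3 (equilibrium
measures are invariant under the dynamics); I. Gallagher, L. Saint-Raymond, B. Texier, *From Newton to
Boltzmann* (2013), Prop. 4.1.1. prover-line-stmt-AtomisticToContinuum-9903-c1-0 (worker S2a).
-/

noncomputable section

open MeasureTheory Filter Set
open scoped ENNReal Topology

namespace Summit.AtomisticToContinuum.HydrodynamicLimit.Theorems.EABirthS2aPre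

open Literature.MathematicalPhysics.KineticTheory
open Summit.AtomisticToContinuum.HydrodynamicLimit.Theorems.BDWS
open Literature.Analysis.FluidPDE (Config HardSphereFlow)
open EABirthS2bA (fields measurable_fields_uncurry)

/-! ## Invariant maps do not change the `L¹` deviation about the mean -/

/-- **Change of variables in the concentration functional.** If `S` is measurable and leaves `μ` invariant,
then for every measurable real `H` the `L¹(μ)` deviation of `H ∘ S` about its Bochner mean equals that of `H`
(both the outer lower integral and the inner Bochner mean are computed through `μ.map S = μ`). -/
theorem lintegral_conc_comp_eq {Ω : Type*} [MeasurableSpace Ω] {μ : Measure Ω} {S : Ω → Ω}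
    (hS : Measurable S) (hinv : μ.map S = μ) {H : Ω → ℝ} (hH : Measurable H) :
    ∫⁻ z, ENNReal.ofReal |H (S z) - ∫ z', H (S z') ∂μ| ∂μ = ∫⁻ z, ENNReal.ofReal |H z - ∫ z', H z' ∂μ| ∂μ := by
  have hmean : ∫ z', H (S z') ∂μ = ∫ z', H z' ∂μ := by
    rw [← integral_map hS.aemeasurable hH.aestronglyMeasurable, hinv]
  have hm : Measurable fun y => ENNReal.ofReal |H y - ∫ z', H z' ∂μ| :=
    (continuous_abs.measurable.comp (hH.sub measurable_const)).ennreal_ofReal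
  rw [hmean, ← lintegral_map hm hS, hinv]

/-! ## The box functional is a static functional evaluated along the flow -/

variable {N : ℕ}

/-- The static box functional `w ↦ ∫ G(Û(w, x)) ψ(x) dx` is measurable in the configuration `w`
(Borel `G`, measurable `ψ`; joint measurability of the box fields, `EABirthS2bA.measurable_fields_uncurry`). -/
theorem measurable_integral_fields (l : ℝ) {G : ℝ × V3 × ℝ → ℝ} (hG : Measurable G) {ψ : T3 → ℝ}
    (hψ : Measurable ψ) : Measurable fun w : Config (N + 1) (Fin 3) T3 => ∫ x, G (fields l w x) * ψ x := by
  have hm : Measurable fun q : Config (N + 1) (Fin 3) T3 × T3 => G (fields l q.1 q.2) * ψ q.2 :=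
    (hG.comp (measurable_fields_uncurry l)).mul (hψ.comp measurable_snd)
  exact hm.stronglyMeasurable.integral_prod_right'.measurable

/-! ## Constant profiles: positive times reduce to statics -/

/-- **Flow-invariance removes time (constant profiles).** For constant profiles `(a, u, θ)`, every reduced
diameter `σ`, particle number, hard-sphere flow `Φ`, time `t`, window `l`, Borel `G` and measurable `ψ`, the
`L¹(P_N)` deviation about the mean of the time-`t` box functional `z ↦ ∫ G(Û(Φ_t z, x)) ψ(x) dx` equals that of
the static functional `w ↦ ∫ G(Û(w, x)) ψ(x) dx` under the same law `P_N = localGibbsLaw σ a u θ N Φ`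
(which `Φ_t` preserves: `map_flow_localGibbsLaw_const`). No hypothesis on `a, θ, σ, l`. -/
theorem lintegral_conc_flow_eq_of_const (σ a θ : ℝ) (u : V3) (N : ℕ)
    (Φ : HardSphereFlow (Literature.Analysis.FluidPDE.Torus.geometry (Fin 3)) (hsDiameter σ N) (N + 1))
    (t l : ℝ) {G : ℝ × V3 × ℝ → ℝ} (hG : Measurable G) {ψ : T3 → ℝ} (hψ : Measurable ψ) :
    ∫⁻ z, ENNReal.ofReal |(∫ x, G (fields l (Φ.flow t z) x) * ψ x) -
        ∫ z', (∫ x, G (fields l (Φ.flow t z') x) * ψ x) ∂(localGibbsLaw σ (fun _ => a) (fun _ => u) (fun _ => θ) N Φ)|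
      ∂(localGibbsLaw σ (fun _ => a) (fun _ => u) (fun _ => θ) N Φ) =
    ∫⁻ z, ENNReal.ofReal |(∫ x, G (fields l z x) * ψ x) -
        ∫ z', (∫ x, G (fields l z' x) * ψ x) ∂(localGibbsLaw σ (fun _ => a) (fun _ => u) (fun _ => θ) N Φ)|
      ∂(localGibbsLaw σ (fun _ => a) (fun _ => u) (fun _ => θ) N Φ) :=
  lintegral_conc_comp_eq (H := fun w => ∫ x, G (fields l w x) * ψ x) (Φ.measurable_flow t)
    (map_flow_localGibbsLaw_const σ a θ u N Φ t) (measurable_integral_fields l hG hψ)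

/-- **S2a along constant profiles is its static instance.** For constant profiles, if the static box
functionals `w ↦ ∫ G(Û_N(w, x)) ψ(x) dx` concentrate about their means in `L¹(P_N)` (a statement about the
canonical Gibbs laws only — no dynamics), then so do the time-`t` box functionals of S2a, for every flow family,
window sequence and time `t`, written exactly as in the stub's signature `Sig.stub_positiveTimeBoxConcentration`. -/
theorem tendsto_conc_flow_of_const (σ a θ : ℝ) (u : V3) (Φ : FlowFamily σ) (ℓ : ℕ → ℝ) (t : ℝ)
    {G : ℝ × V3 × ℝ → ℝ} (hG : Measurable G) {ψ : T3 → ℝ} (hψ : Measurable ψ)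
    (h0 : Tendsto (fun N : ℕ => ∫⁻ z, ENNReal.ofReal |(∫ x, G (fields (ℓ N) z x) * ψ x) -
        ∫ z', (∫ x, G (fields (ℓ N) z' x) * ψ x) ∂(localGibbsLaw σ (fun _ => a) (fun _ => u) (fun _ => θ) N (Φ N))|
      ∂(localGibbsLaw σ (fun _ => a) (fun _ => u) (fun _ => θ) N (Φ N))) atTop (𝓝 0)) :
    Tendsto (fun N : ℕ => ∫⁻ z, ENNReal.ofReal
        |(∫ x, G (boxDensity σ ℓ Φ N t z x, boxMomentum σ ℓ Φ N t z x, boxEnergy σ ℓ Φ N t z x) * ψ x) -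
          ∫ z', (∫ x, G (boxDensity σ ℓ Φ N t z' x, boxMomentum σ ℓ Φ N t z' x, boxEnergy σ ℓ Φ N t z' x) * ψ x)
            ∂(localGibbsLaw σ (fun _ => a) (fun _ => u) (fun _ => θ) N (Φ N))|
      ∂(localGibbsLaw σ (fun _ => a) (fun _ => u) (fun _ => θ) N (Φ N))) atTop (𝓝 0) := by
  refine h0.congr fun N => ?_
  -- the time-`t` box fields are `fields (ℓ N) ((Φ N).flow t z) x` by `rfl`
  exact (lintegral_conc_flow_eq_of_const σ a θ u N (Φ N) t (ℓ N) hG hψ).symm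

/-- **At time `0` the box functional is the static functional almost surely** (general profiles): `Φ_0 = id` on
the good set, which carries the local Gibbs law, so the `t = 0` instance of S2a is a statement about the static
local Gibbs laws only. -/
theorem lintegral_conc_flow_zero_eq (σ : ℝ) (a₀ θ₀ : T3 → ℝ) (u₀ : T3 → V3) (N : ℕ)
    (Φ : HardSphereFlow (Literature.Analysis.FluidPDE.Torus.geometry (Fin 3)) (hsDiameter σ N) (N + 1))
    (l : ℝ) (G : ℝ × V3 × ℝ → ℝ) (ψ : T3 → ℝ) :
    ∫⁻ z, ENNReal.ofReal |(∫ x, G (fields l (Φ.flow 0 z) x) * ψ x) -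
        ∫ z', (∫ x, G (fields l (Φ.flow 0 z') x) * ψ x) ∂(localGibbsLaw σ a₀ u₀ θ₀ N Φ)|
      ∂(localGibbsLaw σ a₀ u₀ θ₀ N Φ) =
    ∫⁻ z, ENNReal.ofReal |(∫ x, G (fields l z x) * ψ x) -
        ∫ z', (∫ x, G (fields l z' x) * ψ x) ∂(localGibbsLaw σ a₀ u₀ θ₀ N Φ)| ∂(localGibbsLaw σ a₀ u₀ θ₀ N Φ) := by
  have hgood : localGibbsLaw σ a₀ u₀ θ₀ N Φ Φ.goodᶜ = 0 := by
    rw [localGibbsLaw_eq]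
    exact localGibbsMeasure_absolutelyContinuous σ a₀ u₀ θ₀ N Φ Φ.measure_compl_good
  have hae : ∀ᵐ z ∂(localGibbsLaw σ a₀ u₀ θ₀ N Φ), Φ.flow 0 z = z := by
    have h : ∀ᵐ z ∂(localGibbsLaw σ a₀ u₀ θ₀ N Φ), z ∈ Φ.good := by rw [ae_iff]; exact hgood
    exact h.mono fun z hz => Φ.flow_zero z hz
  have hmean : (∫ z', (∫ x, G (fields l (Φ.flow 0 z') x) * ψ x) ∂(localGibbsLaw σ a₀ u₀ θ₀ N Φ)) =
      ∫ z', (∫ x, G (fields l z' x) * ψ x) ∂(localGibbsLaw σ a₀ u₀ θ₀ N Φ) :=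
    integral_congr_ae (hae.mono fun z hz => by simp only [hz])
  rw [hmean]
  exact lintegral_congr_ae (hae.mono fun z hz => by simp only [hz])

/-! ## The registered helper stub -/

/-- Signature of the registered helper stub `stub_positiveTimeBoxConcentrationPrelim` (preliminaries of S2a):
(1) a measurable `μ`-invariant map does not change the `L¹(μ)` deviation of a measurable real functional about its
Bochner mean; (2) along CONSTANT profiles, concentration of the static box functionals under the local Gibbs laws
implies the conclusion of `Sig.stub_positiveTimeBoxConcentration` at every time `t`, for every flow family and
window sequence (Borel `G`, measurable `ψ`); (3) for general profiles the `t = 0` deviation functional is the static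
one. -/
def Sig.stub_positiveTimeBoxConcentrationPrelim : Prop :=
  (∀ {Ω : Type} [MeasurableSpace Ω] (μ : Measure Ω) (S : Ω → Ω), Measurable S → μ.map S = μ →
      ∀ H : Ω → ℝ, Measurable H →
        ∫⁻ z, ENNReal.ofReal |H (S z) - ∫ z', H (S z') ∂μ| ∂μ = ∫⁻ z, ENNReal.ofReal |H z - ∫ z', H z' ∂μ| ∂μ) ∧
    (∀ (σ a θ : ℝ) (u : V3) (Φ : FlowFamily σ) (ℓ : ℕ → ℝ) (t : ℝ) (G : ℝ × V3 × ℝ → ℝ), Measurable G →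
      ∀ ψ : T3 → ℝ, Measurable ψ →
        Tendsto (fun N : ℕ => ∫⁻ z, ENNReal.ofReal |(∫ x, G (fields (ℓ N) z x) * ψ x) -
            ∫ z', (∫ x, G (fields (ℓ N) z' x) * ψ x) ∂(localGibbsLaw σ (fun _ => a) (fun _ => u) (fun _ => θ) N (Φ N))|
          ∂(localGibbsLaw σ (fun _ => a) (fun _ => u) (fun _ => θ) N (Φ N))) atTop (𝓝 0) →
        Tendsto (fun N : ℕ => ∫⁻ z, ENNReal.ofReal
            |(∫ x, G (boxDensity σ ℓ Φ N t z x, boxMomentum σ ℓ Φ N t z x, boxEnergy σ ℓ Φ N t z x) * ψ x) -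
              ∫ z', (∫ x, G (boxDensity σ ℓ Φ N t z' x, boxMomentum σ ℓ Φ N t z' x, boxEnergy σ ℓ Φ N t z' x) * ψ x)
                ∂(localGibbsLaw σ (fun _ => a) (fun _ => u) (fun _ => θ) N (Φ N))|
          ∂(localGibbsLaw σ (fun _ => a) (fun _ => u) (fun _ => θ) N (Φ N))) atTop (𝓝 0)) ∧
    ∀ (σ : ℝ) (a₀ θ₀ : T3 → ℝ) (u₀ : T3 → V3) (N : ℕ)
      (Φ : HardSphereFlow (Literature.Analysis.FluidPDE.Torus.geometry (Fin 3)) (hsDiameter σ N) (N + 1))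
      (l : ℝ) (G : ℝ × V3 × ℝ → ℝ) (ψ : T3 → ℝ),
      ∫⁻ z, ENNReal.ofReal |(∫ x, G (fields l (Φ.flow 0 z) x) * ψ x) -
          ∫ z', (∫ x, G (fields l (Φ.flow 0 z') x) * ψ x) ∂(localGibbsLaw σ a₀ u₀ θ₀ N Φ)|
        ∂(localGibbsLaw σ a₀ u₀ θ₀ N Φ) =
      ∫⁻ z, ENNReal.ofReal |(∫ x, G (fields l z x) * ψ x) -
          ∫ z', (∫ x, G (fields l z' x) * ψ x) ∂(localGibbsLaw σ a₀ u₀ θ₀ N Φ)| ∂(localGibbsLaw σ a₀ u₀ θ₀ N Φ)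

/-- **Registered helper stub `stub_positiveTimeBoxConcentrationPrelim`** (crux stmt-AtomisticToContinuum-9903, line
`registered`; preliminaries of the open stub S2a): invariance transfer of the concentration functional, the
reduction of S2a along constant profiles to its static instance, and the `t = 0` reduction to statics. -/
theorem stub_positiveTimeBoxConcentrationPrelim : Sig.stub_positiveTimeBoxConcentrationPrelim :=
  ⟨fun μ _ hS hinv _ hH => lintegral_conc_comp_eq (μ := μ) hS hinv hH,
    fun σ a θ u Φ ℓ t _ hG _ hψ h0 => tendsto_conc_flow_of_const σ a θ u Φ ℓ t hG hψ h0,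
    fun σ a₀ θ₀ u₀ N Φ l G ψ => lintegral_conc_flow_zero_eq σ a₀ θ₀ u₀ N Φ l G ψ⟩

end Summit.AtomisticToContinuum.HydrodynamicLimit.Theorems.EABirthS2aPre

end
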